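import Mathlib
import Literature.Computability.AlgebraicComplexity.NestFreeMatchingPoly
import Summits.ValiantsHypothesis.ValiantsHypothesis.Theorems.FifoMatchingNNDivisionHardReversal
import Summits.ValiantsHypothesis.ValiantsHypothesis.Theorems.FifoMatchingNNDivisionHardCorSandwich
import Summits.ValiantsHypothesis.ValiantsHypothesis.Theorems.FifoMatchingNNMonotoneExpBound
import Summits.ValiantsHypothesis.ValiantsHypothesis.Theses.FifoMatching
import HarnessLib

/-!
# Route FifoMatching — crux `NNDivisionHard` (stmt-ValiantsHypothesis-21181): cofactors with a UNIQUE MAXIMISER of some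
# adjacent-arc degree are not certificates — crux currency and the adjacent-non-generic tier, by name

Assembly of the two unique-maximiser rungs (`AdjacentArcFace.complexity_nn_le_of_unique_max'`: prefix side `L₊(NN_c)`;
`Reversal.complexity_nn_le_of_unique_max_rev`: suffix side `L₊(NN_{n−1−c})`) for the adjacent arc `e = (2c, 2c+1)` of
`[0, 2n)`: one of the two sides has half-length `≥ (n−1)/2`, which eventually exceeds every polylogarithmic threshold.

* `threshold_le_half` — `(log₂ n + c₀ + 4)^{6(c₀+2)} ≤ (n−1)/2` eventually;
* `qp_of_jss_block_bound` — bookkeeping: `L₊(NN_b) ≤ 16((2b+1)(A+3))²` with `(log₂ n + c₀ + 4)^{6(c₀+2)} ≤ b ≤ n` forces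
  `2^((log₂ n + c₀)^{c₀}) < A + X` (stretched-exponential bound `2^{b^{1/6}} ≤ L₊(NN_b)` at the block scale);
* ★★ `adjacentUniqueMax_not_certificate_qp` — **for every `c₀`, eventually in `n`: every `h ≠ 0` with a monomial of
  STRICTLY LARGEST `x_{(2c,2c+1)}`-degree, for some `c + 1 ≤ n`, satisfies `2^((log₂ n + c₀)^{c₀}) < L₊(NN_n · h) + L₊(h)`**
  (e.g. every two-matching cofactor `x^{kP} + x^{kQ}` with an adjacent arc in `P △ Q` — step (t3) of the hands' census);
* ★ `nnDivisionHard_iff_adjacentNonGenericTier` — BY NAME: `Theses.FifoMatching.NNDivisionHard` ⟺ the same inequality for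
  the cofactors in which EVERY adjacent-arc degree `deg_{x_{(2c,2c+1)}}` is attained by at least two monomials.

HONEST FRAMING: a rung family and a by-name localisation; the residual (… ∧ block-dense ∧ prefix-shadow-non-generic ∧
adjacent-non-generic) stays OPEN (Hrubeš–Yehudayoff 2021 §6 Problem 2); nothing here bears on `NNNotVP` or on VP ≠ VNP
(NOT proved).
References: Jukna–Seiwert–Sergeev 2022 Thm 1 [JuknaSeiwertSergeev2022]; Hrubeš–Yehudayoff 2021 §6 Problem 2
[HrubesYehudayoff2021].
-/

noncomputable section

-- Sub = Summit single-conjunct layout: the duplicated namespace component is mandated by the tree.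
set_option linter.dupNamespace false
set_option autoImplicit false

namespace Summit.ValiantsHypothesis.ValiantsHypothesis.Theorems.FifoMatching.NNDivisionHard.AdjacentArcTier

open Finset MvPolynomial Literature.Computability.AlgebraicComplexity
open Summit.ValiantsHypothesis.ValiantsHypothesis.Theorems.FifoMatching.NNDivisionHard.AdjacentArcFace
  (complexity_nn_le_of_unique_max')
open Summit.ValiantsHypothesis.ValiantsHypothesis.Theorems.FifoMatching.NNDivisionHard.Reversal
  (complexity_nn_le_of_unique_max_rev)
open scoped NNReal BigOperators

/-! ### §1 Bookkeeping -/

/-- The polylogarithmic block threshold is eventually below `(n−1)/2`. [folklore] -/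
theorem threshold_le_half (c₀ : ℕ) :
    ∃ n₀ : ℕ, ∀ n : ℕ, n₀ ≤ n → (Nat.log 2 n + c₀ + 4) ^ (6 * (c₀ + 2)) ≤ (n - 1) / 2 := by
  obtain ⟨h₀, hh₀⟩ := CorSandwich.polylog_lt_rpow_eventually (6 * (c₀ + 2)) (c := 1 / 2) (by norm_num)
  refine ⟨max h₀ 2, fun n hn => ?_⟩
  have hn0 : h₀ ≤ n := le_trans (le_max_left _ _) hn
  have hn2 : 2 ≤ n := le_trans (le_max_right _ _) hn
  set X := (Nat.log 2 n + 6 * (c₀ + 2)) ^ (6 * (c₀ + 2)) with hX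
  have hP : ((X : ℕ) : ℝ) < (n : ℝ) ^ (1 / 2 : ℝ) := by rw [hX]; exact_mod_cast hh₀ n hn0
  have hsq : ((n : ℝ) ^ (1 / 2 : ℝ)) ^ 2 = n := by
    rw [← Real.rpow_natCast, ← Real.rpow_mul (Nat.cast_nonneg n)]
    norm_num
  have hX2 : ((X ^ 2 : ℕ) : ℝ) < (n : ℝ) := by
    rw [Nat.cast_pow, ← hsq]
    exact pow_lt_pow_left₀ hP (Nat.cast_nonneg _) two_ne_zero
  have hX2' : X ^ 2 < n := by exact_mod_cast hX2
  have hX3 : 3 ≤ X := by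
    rw [hX]
    calc 3 ≤ Nat.log 2 n + 6 * (c₀ + 2) := by omega
      _ ≤ (Nat.log 2 n + 6 * (c₀ + 2)) ^ (6 * (c₀ + 2)) := Nat.le_self_pow (by omega) _
  have hmono : (Nat.log 2 n + c₀ + 4) ^ (6 * (c₀ + 2)) ≤ X := Nat.pow_le_pow_left (by omega) _
  have h3X : 3 * X ≤ X ^ 2 := by rw [sq]; exact Nat.mul_le_mul_right _ hX3
  omega

/-- **Quasi-polynomial bookkeeping at a block scale**: `L₊(NN_b) ≤ 16((2b+1)(A+3))²` with
`(log₂ n + c₀ + 4)^{6(c₀+2)} ≤ b ≤ n` forces `2^((log₂ n + c₀)^{c₀}) < A + X`, eventually in `n`. [folklore] -/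
theorem qp_of_jss_block_bound (c₀ : ℕ) : ∃ n₀ : ℕ, ∀ n : ℕ, n₀ ≤ n → ∀ b : ℕ, b ≤ n →
    (Nat.log 2 n + c₀ + 4) ^ (6 * (c₀ + 2)) ≤ b → ∀ A X : ℕ,
    complexity (nestFreeMatchingPoly b ℝ≥0) ≤ 16 * ((2 * b + 1) * (A + 3)) ^ 2 →
    2 ^ ((Nat.log 2 n + c₀) ^ c₀) < A + X := by
  obtain ⟨n₁, hn₁⟩ := NNMonotoneExpBound.exp_lower_bound
  refine ⟨2 ^ (n₁ + 1), fun n hn b hb hbig A X h3 => ?_⟩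
  have hℓ1 : n₁ + 1 ≤ Nat.log 2 n := Nat.le_log_of_pow_le Nat.one_lt_two hn
  set ℓ := Nat.log 2 n with hℓ
  have hT6 : ((ℓ + c₀ + 4) ^ (c₀ + 2)) ^ 6 ≤ b := by rw [← pow_mul, mul_comm]; exact hbig
  have hbT : n₁ ≤ b := by
    have : ℓ + c₀ + 4 ≤ (ℓ + c₀ + 4) ^ (6 * (c₀ + 2)) := Nat.le_self_pow (by omega) _
    omega
  -- `2^T ≤ L₊(NN_b)`
  have hX : 2 ^ ((ℓ + c₀ + 4) ^ (c₀ + 2)) ≤ complexity (nestFreeMatchingPoly b ℝ≥0) := by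
    set T := (ℓ + c₀ + 4) ^ (c₀ + 2) with hT
    have h6 : (((T : ℝ) ^ 6)) ^ ((1 : ℝ) / 6) = T := by
      rw [one_div, show (6 : ℝ) = ((6 : ℕ) : ℝ) by norm_num]
      exact Real.pow_rpow_inv_natCast (Nat.cast_nonneg _) (by norm_num)
    have e1 : (T : ℝ) ≤ (b : ℝ) ^ ((1 : ℝ) / 6) := by
      calc (T : ℝ) = ((T : ℝ) ^ 6) ^ ((1 : ℝ) / 6) := h6.symm
        _ ≤ (b : ℝ) ^ ((1 : ℝ) / 6) := Real.rpow_le_rpow (by positivity) (by exact_mod_cast hT6) (by norm_num)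
    have e2 : (2 : ℝ) ^ (T : ℝ) ≤ (2 : ℝ) ^ ((b : ℝ) ^ ((1 : ℝ) / 6)) :=
      Real.rpow_le_rpow_of_exponent_le one_le_two e1
    have e3 : ((2 ^ T : ℕ) : ℝ) ≤ (complexity (nestFreeMatchingPoly b ℝ≥0) : ℝ) := by
      rw [Nat.cast_pow, Nat.cast_ofNat, ← Real.rpow_natCast]
      exact e2.trans (hn₁ b hbT)
    exact_mod_cast e3
  have hTE : 2 * (ℓ + c₀) ^ c₀ + 2 * ℓ + 14 ≤ (ℓ + c₀ + 4) ^ (c₀ + 2) := by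
    -- (inlined from `SplitFaceGeneric.two_mul_pow_add_le`, whose module imports the route file)
    have hE : 1 ≤ (ℓ + c₀) ^ c₀ := Nat.one_le_pow _ _ (by omega)
    have h1 : (ℓ + c₀) ^ c₀ ≤ (ℓ + c₀ + 4) ^ c₀ := Nat.pow_le_pow_left (by omega) c₀
    have h2 : 5 * ℓ + 20 ≤ (ℓ + c₀ + 4) ^ 2 :=
      calc 5 * ℓ + 20 = 5 * (ℓ + 4) := by ring
        _ ≤ (ℓ + c₀ + 4) * (ℓ + c₀ + 4) := Nat.mul_le_mul (by omega) (by omega)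
        _ = (ℓ + c₀ + 4) ^ 2 := (sq _).symm
    have h3 : 5 * ℓ + 18 ≤ (ℓ + c₀) ^ c₀ * (5 * ℓ + 18) := Nat.le_mul_of_pos_left _ hE
    calc 2 * (ℓ + c₀) ^ c₀ + 2 * ℓ + 14 ≤ 2 * (ℓ + c₀) ^ c₀ + (ℓ + c₀) ^ c₀ * (5 * ℓ + 18) := by omega
      _ = (ℓ + c₀) ^ c₀ * (5 * ℓ + 20) := by ring
      _ ≤ (ℓ + c₀ + 4) ^ c₀ * (ℓ + c₀ + 4) ^ 2 := Nat.mul_le_mul h1 h2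
      _ = (ℓ + c₀ + 4) ^ (c₀ + 2) := by rw [← pow_add]
  have hlogn : 2 * n + 1 ≤ 2 ^ (ℓ + 2) := by
    have := Nat.lt_pow_succ_log_self Nat.one_lt_two n
    rw [hℓ, pow_succ] at *
    omega
  have hb2 : 2 * b + 1 ≤ 2 ^ (ℓ + 2) := by omega
  have H1 : 2 ^ (2 * (ℓ + c₀) ^ c₀ + 2 * ℓ + 14) ≤ 16 * (2 ^ (ℓ + 2) * (A + 3)) ^ 2 :=
    calc 2 ^ (2 * (ℓ + c₀) ^ c₀ + 2 * ℓ + 14) ≤ 2 ^ ((ℓ + c₀ + 4) ^ (c₀ + 2)) := Nat.pow_le_pow_right Nat.two_pos hTE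
      _ ≤ complexity (nestFreeMatchingPoly b ℝ≥0) := hX
      _ ≤ 16 * ((2 * b + 1) * (A + 3)) ^ 2 := h3
      _ ≤ 16 * (2 ^ (ℓ + 2) * (A + 3)) ^ 2 := by gcongr
  have H2 : 2 ^ (2 * (ℓ + c₀) ^ c₀ + 2 * ℓ + 14) = 16 * (2 ^ (ℓ + 2)) ^ 2 * (2 ^ ((ℓ + c₀) ^ c₀ + 3)) ^ 2 := by
    rw [← pow_mul, ← pow_mul, show (16 : ℕ) = 2 ^ 4 by norm_num, ← pow_add, ← pow_add]
    congr 1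
    ring
  have H3 : (2 ^ ((ℓ + c₀) ^ c₀ + 3)) ^ 2 ≤ (A + 3) ^ 2 := by
    have hK : 0 < 16 * (2 ^ (ℓ + 2)) ^ 2 := by positivity
    rw [H2, mul_pow] at H1
    rw [← mul_assoc] at H1
    exact Nat.le_of_mul_le_mul_left H1 hK
  have H4 : 2 ^ ((ℓ + c₀) ^ c₀ + 3) ≤ A + 3 := (Nat.pow_le_pow_iff_left (by norm_num)).1 H3
  have hE1 : 1 ≤ 2 ^ ((ℓ + c₀) ^ c₀) := Nat.one_le_two_pow
  have h8 : 2 ^ ((ℓ + c₀) ^ c₀ + 3) = 8 * 2 ^ ((ℓ + c₀) ^ c₀) := by ring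
  omega

/-! ### §2 Crux currency -/

/-- ★★ **A UNIQUE MAXIMISER OF SOME ADJACENT-ARC DEGREE IS FATAL FOR A CERTIFICATE.**  For every `c₀`, eventually in `n`:
if for some adjacent arc `e = (2c, 2c+1)` (`c + 1 ≤ n`) one monomial `m₀` of `h` has strictly larger `x_e`-degree than every
other monomial of `h`, then `2^((log₂ n + c₀)^{c₀}) < L₊(NN_n · h) + L₊(h)`. [cite: JuknaSeiwertSergeev2022, Thm 1]
[cite: HrubesYehudayoff2021, §6 Problem 2] -/
theorem adjacentUniqueMax_not_certificate_qp (c₀ : ℕ) : ∃ n₀ : ℕ, ∀ n : ℕ, n₀ ≤ n → ∀ c : ℕ, ∀ hc : c + 1 ≤ n,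
    ∀ h : MvPolynomial (Fin (2 * n) × Fin (2 * n)) ℝ≥0, ∀ m₀ ∈ h.support,
    (∀ m ∈ h.support, m ≠ m₀ →
      m (⟨2 * c, by omega⟩, ⟨2 * c + 1, by omega⟩) < m₀ (⟨2 * c, by omega⟩, ⟨2 * c + 1, by omega⟩)) →
    2 ^ ((Nat.log 2 n + c₀) ^ c₀) < complexity (nestFreeMatchingPoly n ℝ≥0 * h) + complexity h := by
  obtain ⟨n₁, hn₁⟩ := qp_of_jss_block_bound c₀
  obtain ⟨n₂, hn₂⟩ := threshold_le_half c₀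
  refine ⟨max n₁ n₂, fun n hn c hc h m₀ hm₀ huniq => ?_⟩
  have hn1 : n₁ ≤ n := le_trans (le_max_left _ _) hn
  have hthr := hn₂ n (le_trans (le_max_right _ _) hn)
  by_cases hcase : (Nat.log 2 n + c₀ + 4) ^ (6 * (c₀ + 2)) ≤ c
  · exact hn₁ n hn1 c (by omega) hcase _ _ (complexity_nn_le_of_unique_max' hc hm₀ huniq)
  · exact hn₁ n hn1 (n - 1 - c) (by omega) (by omega) _ _ (complexity_nn_le_of_unique_max_rev hc hm₀ huniq)

/-! ### §3 By name -/

/-- ★ **BY NAME: `NNDivisionHard` ⟺ its ADJACENT-NON-GENERIC tier.**  The crux (stmt-ValiantsHypothesis-21181) is equivalent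
to the same inequality for the cofactors in which, for EVERY adjacent arc `e = (2c, 2c+1)` of `[0, 2n)`, no monomial has
strictly largest `x_e`-degree (the maximal `x_e`-degree is attained at least twice). [cite: HrubesYehudayoff2021, §6 Problem 2] -/
theorem nnDivisionHard_iff_adjacentNonGenericTier :
    Summit.ValiantsHypothesis.ValiantsHypothesis.Theses.FifoMatching.NNDivisionHard ↔
    ∀ c₀ : ℕ, ∃ n₀ : ℕ, ∀ n ≥ n₀, ∀ h : MvPolynomial (Fin (2 * n) × Fin (2 * n)) ℝ≥0, h ≠ 0 →
      (∀ c : ℕ, ∀ hc : c + 1 ≤ n, ∀ m₀ ∈ h.support, ∃ m ∈ h.support, m ≠ m₀ ∧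
        m₀ (⟨2 * c, by omega⟩, ⟨2 * c + 1, by omega⟩) ≤ m (⟨2 * c, by omega⟩, ⟨2 * c + 1, by omega⟩)) →
      2 ^ ((Nat.log 2 n + c₀) ^ c₀) < complexity (nestFreeMatchingPoly n ℝ≥0 * h) + complexity h := by
  constructor
  · intro hN c₀
    obtain ⟨n₀, hn₀⟩ := hN c₀
    exact ⟨n₀, fun n hn h hh _ => hn₀ n hn h hh⟩
  · intro H c₀
    obtain ⟨n₀, hn₀⟩ := H c₀
    obtain ⟨n₁, hn₁⟩ := adjacentUniqueMax_not_certificate_qp c₀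
    refine ⟨max n₀ n₁, fun n hn h hh => ?_⟩
    by_contra hcon
    apply hcon
    apply hn₀ n (le_trans (le_max_left _ _) hn) h hh
    intro c hc m₀ hm₀
    by_contra hne
    refine hcon (hn₁ n (le_trans (le_max_right _ _) hn) c hc h m₀ hm₀ fun m hm hmne => ?_)
    by_contra hlt
    exact hne ⟨m, hm, hmne, not_lt.1 hlt⟩

end Summit.ValiantsHypothesis.ValiantsHypothesis.Theorems.FifoMatching.NNDivisionHard.AdjacentArcTier

end
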